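import Mathlib
import Summits.ValiantsHypothesis.ValiantsHypothesis.Theses.GeneratorObstructions
import Summits.ValiantsHypothesis.ValiantsHypothesis.Theorems.GeneratorObstructionsGenInheritanceUpper
import Summits.ValiantsHypothesis.ValiantsHypothesis.Theorems.GeneratorObstructionsPerGenDegreeSuperQPAmbientTransfer

/-!
# K2 `PowGenDegreeQP` (stmt-ValiantsHypothesis-11655), line `trace-side-regimes`:
# K2 is an ASYMPTOTIC statement — modulo finiteness of the generator types of each cell `(m, e)`,
# K2 is equivalent to its restriction to the rows `m ≥ M₀` for EVERY `M₀`

Helper file (`--supports stmt-ValiantsHypothesis-11655`).  Calibration of what the row closures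
(`…RowOne`, `…RowTwo`) mean.  For each cell `(m, n = m + e)` the covariant algebra
`A(Δ_m(tr X_n^m)) = k[Δ_m(tr X_n^m)]^U` is finitely generated (Hadžiev 1967 / Grosshans 1997 Thm. 9.4:
`k[X]^U` is finitely generated for an affine `G`-variety `X`), so only finitely many weights `χ` are
generator types (`γ_χ ≠ 0`).  ASSUMING that finiteness for the finitely many rows `m < M₀` (hypothesis
`hfin`, explicit — it is not proved in the tree), the bottom rows of the window impose no
constraint at all: for every `c` the cells `(m, e)` with `m < M₀`, `m + e ≤ 2^((log₂ m + c)^c)` are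
finitely many, their generator degrees are bounded by some `D`, and the exponent
`c₀ = max(c₀', D + 1)` serves all rows (`powGenDegreeQP_iff_le_of_finite_genTypes`; the same for
the two registered stubs: `stub_sliceGen_iff_le_of_finite_genTypes`, `stub_wideGen_iff_le_of_finite_genTypes`).
The hypothesis descends from the AMBIENT covariant algebra `ℂ[Sym^m ℂ^{(m+e)²}]^U` (Hilbert's
finiteness theorem for covariants of forms, 1890 — untyped) by `γ_χ(Δ_m f) ≤ γ_χ(ℂ[Sym^m])`
(`finite_genTypes_of_finite_ambient_genTypes`, `powGenDegreeQP_iff_le_of_finite_ambient_genTypes`).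

Consequently the CONTENT of K2 (and of both registered stubs, `…_iff_three_le`) is purely asymptotic
in `m`: an effective row closure (rows `m ≤ 2`: `-|χ| ≤ 1`, `-|χ| ≤ 2n²`) is calibration, and no
finite set of rows settles the crux either way.  Honest label: conditional reduction (hypothesis =
finiteness of generator types per cell, classical but untyped); rows `m ≥ 3` OPEN.
-/

namespace Summit.ValiantsHypothesis.ValiantsHypothesis.Theorems.GeneratorObstructions.PowGenDegreeQP

open MvPolynomial
open Literature.NumberTheory.DiophantineGeometry Literature.Computability.AlgebraicComplexity
open Summit.ValiantsHypothesis.ValiantsHypothesis.Theses.GeneratorObstructions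

-- `Summit.ValiantsHypothesis.ValiantsHypothesis.…` is the tree's mandated single-conjunct layout.
set_option linter.dupNamespace false

noncomputable section

/-- Inside the window, the cells of the rows `m < M₀` have `e ≤ 2^((log₂ M₀ + c)^c)`. [folklore] -/
theorem e_le_of_window_of_lt {c M₀ m e : ℕ} (hm : m < M₀)
    (he : m + e ≤ 2 ^ ((Nat.log 2 m + c) ^ c)) : e ≤ 2 ^ ((Nat.log 2 M₀ + c) ^ c) := by
  have h1 : 2 ^ ((Nat.log 2 m + c) ^ c) ≤ 2 ^ ((Nat.log 2 M₀ + c) ^ c) :=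
    Nat.pow_le_pow_right (by norm_num)
      (Nat.pow_le_pow_left (Nat.add_le_add_right (Nat.log_mono_right hm.le) c) c)
  omega

/-- **A uniform degree bound on finitely many finite cells**: if for every row `1 ≤ m < M₀` and every
`e` the generator types of `A(Δ_m(tr X_{m+e}^m))` form a finite set, then for every `E` there is
`D` bounding `-|χ|` for all generator types `χ` of all cells `m < M₀`, `e ≤ E`. [folklore] -/
theorem exists_degree_bound_of_finite_genTypes (M₀ E : ℕ)
    (hfin : ∀ m e : ℕ, 1 ≤ m → m < M₀ →
      Set.Finite {χ : Weight (MatIdx (m + e)) |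
        Module.finrank ℂ (↥(highestWeightSpace (orbitCoordRep (powFormLex ℂ (m + e) m) m) χ) ⧸
          Submodule.comap (highestWeightSpace (orbitCoordRep (powFormLex ℂ (m + e) m) m) χ).subtype
            (⨆ p : Weight (MatIdx (m + e)) × Weight (MatIdx (m + e)),
              ⨆ (_ : p.1 + p.2 = χ ∧ p.1 ≠ 0 ∧ p.2 ≠ 0),
                highestWeightSpace (orbitCoordRep (powFormLex ℂ (m + e) m) m) p.1 *
                  highestWeightSpace (orbitCoordRep (powFormLex ℂ (m + e) m) m) p.2)) ≠ 0}) :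
    ∃ D : ℕ, ∀ m e : ℕ, 1 ≤ m → m < M₀ → e ≤ E → ∀ χ : Weight (MatIdx (m + e)),
      Module.finrank ℂ (↥(highestWeightSpace (orbitCoordRep (powFormLex ℂ (m + e) m) m) χ) ⧸
        Submodule.comap (highestWeightSpace (orbitCoordRep (powFormLex ℂ (m + e) m) m) χ).subtype
          (⨆ p : Weight (MatIdx (m + e)) × Weight (MatIdx (m + e)),
            ⨆ (_ : p.1 + p.2 = χ ∧ p.1 ≠ 0 ∧ p.2 ≠ 0),
              highestWeightSpace (orbitCoordRep (powFormLex ℂ (m + e) m) m) p.1 *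
                highestWeightSpace (orbitCoordRep (powFormLex ℂ (m + e) m) m) p.2)) ≠ 0 →
      -(Weight.size χ) ≤ (D : ℤ) := by
  classical
  -- a bound for each single cell
  have hcell : ∀ m e : ℕ, 1 ≤ m → m < M₀ → ∃ d : ℕ, ∀ χ : Weight (MatIdx (m + e)),
      Module.finrank ℂ (↥(highestWeightSpace (orbitCoordRep (powFormLex ℂ (m + e) m) m) χ) ⧸
        Submodule.comap (highestWeightSpace (orbitCoordRep (powFormLex ℂ (m + e) m) m) χ).subtype
          (⨆ p : Weight (MatIdx (m + e)) × Weight (MatIdx (m + e)),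
            ⨆ (_ : p.1 + p.2 = χ ∧ p.1 ≠ 0 ∧ p.2 ≠ 0),
              highestWeightSpace (orbitCoordRep (powFormLex ℂ (m + e) m) m) p.1 *
                highestWeightSpace (orbitCoordRep (powFormLex ℂ (m + e) m) m) p.2)) ≠ 0 →
      -(Weight.size χ) ≤ (d : ℤ) := by
    intro m e hm hM
    obtain ⟨d, hd⟩ := ((hfin m e hm hM).image fun χ => (-Weight.size χ).toNat).bddAbove
    refine ⟨d, fun χ hχ => ?_⟩
    have h1 : (-Weight.size χ).toNat ≤ d := hd (Set.mem_image_of_mem _ hχ)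
    have h2 : -Weight.size χ ≤ ((-Weight.size χ).toNat : ℤ) := Int.self_le_toNat _
    omega
  -- sum the cell bounds over the finitely many cells
  let d : ℕ → ℕ → ℕ := fun m e => if h : 1 ≤ m ∧ m < M₀ then (hcell m e h.1 h.2).choose else 0
  refine ⟨∑ m ∈ Finset.range M₀, ∑ e ∈ Finset.range (E + 1), d m e, ?_⟩
  intro m e hm hM hE χ hχ
  have h1 : -(Weight.size χ) ≤ (d m e : ℤ) := by
    have h := (hcell m e hm hM).choose_spec χ hχ
    simp only [d, dif_pos (And.intro hm hM)]
    exact h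
  have h2 : d m e ≤ ∑ e' ∈ Finset.range (E + 1), d m e' :=
    Finset.single_le_sum (f := fun e' => d m e') (fun _ _ => Nat.zero_le _)
      (Finset.mem_range.mpr (Nat.lt_succ_of_le hE))
  have h3 : ∑ e' ∈ Finset.range (E + 1), d m e' ≤
      ∑ m' ∈ Finset.range M₀, ∑ e' ∈ Finset.range (E + 1), d m' e' :=
    Finset.single_le_sum (f := fun m' => ∑ e' ∈ Finset.range (E + 1), d m' e')
      (fun _ _ => Nat.zero_le _) (Finset.mem_range.mpr hM)
  have h4 : (d m e : ℤ) ≤ ((∑ m' ∈ Finset.range M₀, ∑ e' ∈ Finset.range (E + 1), d m' e' : ℕ) : ℤ) := by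
    exact_mod_cast h2.trans h3
  exact h1.trans h4

/-- A natural number `D` is below the K2 bound with exponent `D + 1`: `D ≤ m · 2^((log₂ m + (D+1))^(D+1))`
for `1 ≤ m`. [folklore] -/
theorem le_bound_succ (D m : ℕ) (hm : 1 ≤ m) :
    (D : ℤ) ≤ (m : ℤ) * 2 ^ ((Nat.log 2 m + (D + 1)) ^ (D + 1)) := by
  have h1 : D + 1 ≤ (Nat.log 2 m + (D + 1)) ^ (D + 1) :=
    (Nat.le_add_left (D + 1) (Nat.log 2 m)).trans (Nat.le_self_pow (Nat.succ_ne_zero D) _)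
  have h2 : D < 2 ^ (D + 1) := (Nat.lt_two_pow_self).trans (Nat.pow_lt_pow_right (by norm_num) (by omega))
  have h3 : 2 ^ (D + 1) ≤ 2 ^ ((Nat.log 2 m + (D + 1)) ^ (D + 1)) := Nat.pow_le_pow_right (by norm_num) h1
  have h4 : (D : ℤ) ≤ ((2 ^ ((Nat.log 2 m + (D + 1)) ^ (D + 1)) : ℕ) : ℤ) := by exact_mod_cast (h2.le.trans h3)
  have h5 : ((2 ^ ((Nat.log 2 m + (D + 1)) ^ (D + 1)) : ℕ) : ℤ) ≤
      (m : ℤ) * 2 ^ ((Nat.log 2 m + (D + 1)) ^ (D + 1)) := by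
    push_cast
    have hm' : (1 : ℤ) ≤ m := by exact_mod_cast hm
    nlinarith [pow_pos (show (0 : ℤ) < 2 by norm_num) ((Nat.log 2 m + (D + 1)) ^ (D + 1))]
  exact h4.trans h5

/-- **K2 is asymptotic** (conditional reduction): if the generator types of every cell `(m, e)` with
`m < M₀` form a finite set (finite generation of the covariant algebra — Hadžiev/Grosshans — NOT
proved here; explicit hypothesis), then the route decl `PowGenDegreeQP` (verbatim) is equivalent to
its restriction to the rows `m ≥ M₀`.  The rows below `M₀` are absorbed into the exponent
`c₀ = max c₀' (D + 1)`, `D` a degree bound on the finitely many finite cells of the window. [folklore] -/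
theorem powGenDegreeQP_iff_le_of_finite_genTypes (M₀ : ℕ)
    (hfin : ∀ m e : ℕ, 1 ≤ m → m < M₀ →
      Set.Finite {χ : Weight (MatIdx (m + e)) |
        Module.finrank ℂ (↥(highestWeightSpace (orbitCoordRep (powFormLex ℂ (m + e) m) m) χ) ⧸
          Submodule.comap (highestWeightSpace (orbitCoordRep (powFormLex ℂ (m + e) m) m) χ).subtype
            (⨆ p : Weight (MatIdx (m + e)) × Weight (MatIdx (m + e)),
              ⨆ (_ : p.1 + p.2 = χ ∧ p.1 ≠ 0 ∧ p.2 ≠ 0),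
                highestWeightSpace (orbitCoordRep (powFormLex ℂ (m + e) m) m) p.1 *
                  highestWeightSpace (orbitCoordRep (powFormLex ℂ (m + e) m) m) p.2)) ≠ 0}) :
    PowGenDegreeQP ↔
      ∀ c : ℕ, ∃ c₀ : ℕ, ∀ m e : ℕ, M₀ ≤ m → 1 ≤ m → m + e ≤ 2 ^ ((Nat.log 2 m + c) ^ c) →
        ∀ χ : Weight (MatIdx (m + e)),
          Module.finrank ℂ (↥(highestWeightSpace (orbitCoordRep (powFormLex ℂ (m + e) m) m) χ) ⧸
            Submodule.comap (highestWeightSpace (orbitCoordRep (powFormLex ℂ (m + e) m) m) χ).subtype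
              (⨆ p : Weight (MatIdx (m + e)) × Weight (MatIdx (m + e)),
                ⨆ (_ : p.1 + p.2 = χ ∧ p.1 ≠ 0 ∧ p.2 ≠ 0),
                  highestWeightSpace (orbitCoordRep (powFormLex ℂ (m + e) m) m) p.1 *
                    highestWeightSpace (orbitCoordRep (powFormLex ℂ (m + e) m) m) p.2)) ≠ 0 →
          -(Weight.size χ) ≤ (m : ℤ) * 2 ^ ((Nat.log 2 m + c₀) ^ c₀) := by
  unfold PowGenDegreeQP
  constructor
  · intro h c
    obtain ⟨c₀, hc₀⟩ := h c
    exact ⟨c₀, fun m e _ hm he χ hγ => hc₀ m e hm he χ hγ⟩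
  · intro h c
    obtain ⟨c₀, hc₀⟩ := h c
    obtain ⟨D, hD⟩ := exists_degree_bound_of_finite_genTypes M₀ (2 ^ ((Nat.log 2 M₀ + c) ^ c)) hfin
    -- monotonicity of the bound in the exponent (as in `…RowTwo.bound_mono_of_le`, kept local to
    -- stay out of the theses cone of that file)
    have bound_mono_of_le : ∀ (m : ℕ) {a a' : ℕ}, a ≤ a' →
        (m : ℤ) * 2 ^ ((Nat.log 2 m + a) ^ a) ≤ (m : ℤ) * 2 ^ ((Nat.log 2 m + a') ^ a') := by
      intro m a a' h
      have hmono : (Nat.log 2 m + a) ^ a ≤ (Nat.log 2 m + a') ^ a' := by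
        rcases Nat.eq_zero_or_pos (Nat.log 2 m + a') with h0 | hpos
        · have ha' : a' = 0 := by omega
          have ha : a = 0 := by omega
          subst ha'; subst ha; simp
        · exact (Nat.pow_le_pow_left (by omega) a).trans (Nat.pow_le_pow_right hpos h)
      exact mul_le_mul_of_nonneg_left (pow_le_pow_right₀ (by norm_num) hmono) (by positivity)
    refine ⟨max c₀ (D + 1), fun m e hm he χ hγ => ?_⟩
    rcases Nat.lt_or_ge m M₀ with hlt | hge
    · exact ((hD m e hm hlt (e_le_of_window_of_lt hlt he) χ hγ).trans (le_bound_succ D m hm)).trans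
        (bound_mono_of_le m (le_max_right _ _))
    · exact (hc₀ m e hge hm he χ hγ).trans (bound_mono_of_le m (le_max_left _ _))

/-! ## The registered stubs are asymptotic too -/

/-- **`stub_sliceGen` is asymptotic** (conditional reduction, same hypothesis): modulo finiteness of
the generator types of the cells `m < M₀`, the registered stub `stub_sliceGen` (verbatim body on the
left) is equivalent to its restriction to the rows `m ≥ M₀`, for every `M₀`. [folklore] -/
theorem stub_sliceGen_iff_le_of_finite_genTypes (M₀ : ℕ)
    (hfin : ∀ m e : ℕ, 1 ≤ m → m < M₀ →
      Set.Finite {χ : Weight (MatIdx (m + e)) |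
        Module.finrank ℂ (↥(highestWeightSpace (orbitCoordRep (powFormLex ℂ (m + e) m) m) χ) ⧸
          Submodule.comap (highestWeightSpace (orbitCoordRep (powFormLex ℂ (m + e) m) m) χ).subtype
            (⨆ p : Weight (MatIdx (m + e)) × Weight (MatIdx (m + e)),
              ⨆ (_ : p.1 + p.2 = χ ∧ p.1 ≠ 0 ∧ p.2 ≠ 0),
                highestWeightSpace (orbitCoordRep (powFormLex ℂ (m + e) m) m) p.1 *
                  highestWeightSpace (orbitCoordRep (powFormLex ℂ (m + e) m) m) p.2)) ≠ 0}) :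
    (∀ c : ℕ, ∃ c₀ : ℕ, ∀ m e : ℕ, 1 ≤ m → m + e ≤ 2 ^ ((Nat.log 2 m + c) ^ c) →
      ∀ ι : MatIdx m → MatIdx (m + e), StrictMono ι → IsUpperSet (Set.range ι) →
        ∀ χ : Weight (MatIdx m),
          Module.finrank ℂ (↥(highestWeightSpace (orbitCoordRep (powFormLex ℂ (m + e) m) m) (Function.extend ι χ 0)) ⧸ Submodule.comap (highestWeightSpace (orbitCoordRep (powFormLex ℂ (m + e) m) m) (Function.extend ι χ 0)).subtype (⨆ p : Weight (MatIdx (m + e)) × Weight (MatIdx (m + e)), ⨆ (_ : p.1 + p.2 = (Function.extend ι χ 0) ∧ p.1 ≠ 0 ∧ p.2 ≠ 0), highestWeightSpace (orbitCoordRep (powFormLex ℂ (m + e) m) m) p.1 * highestWeightSpace (orbitCoordRep (powFormLex ℂ (m + e) m) m) p.2)) ≠ 0 →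
            -(Weight.size χ) ≤ (m : ℤ) * 2 ^ ((Nat.log 2 m + c₀) ^ c₀)) ↔
    (∀ c : ℕ, ∃ c₀ : ℕ, ∀ m e : ℕ, M₀ ≤ m → 1 ≤ m → m + e ≤ 2 ^ ((Nat.log 2 m + c) ^ c) →
      ∀ ι : MatIdx m → MatIdx (m + e), StrictMono ι → IsUpperSet (Set.range ι) →
        ∀ χ : Weight (MatIdx m),
          Module.finrank ℂ (↥(highestWeightSpace (orbitCoordRep (powFormLex ℂ (m + e) m) m) (Function.extend ι χ 0)) ⧸ Submodule.comap (highestWeightSpace (orbitCoordRep (powFormLex ℂ (m + e) m) m) (Function.extend ι χ 0)).subtype (⨆ p : Weight (MatIdx (m + e)) × Weight (MatIdx (m + e)), ⨆ (_ : p.1 + p.2 = (Function.extend ι χ 0) ∧ p.1 ≠ 0 ∧ p.2 ≠ 0), highestWeightSpace (orbitCoordRep (powFormLex ℂ (m + e) m) m) p.1 * highestWeightSpace (orbitCoordRep (powFormLex ℂ (m + e) m) m) p.2)) ≠ 0 →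
            -(Weight.size χ) ≤ (m : ℤ) * 2 ^ ((Nat.log 2 m + c₀) ^ c₀)) := by
  constructor
  · intro h c
    obtain ⟨c₀, hc₀⟩ := h c
    exact ⟨c₀, fun m e _ hm he ι hι hup χ hγ => hc₀ m e hm he ι hι hup χ hγ⟩
  · intro h c
    obtain ⟨c₀, hc₀⟩ := h c
    obtain ⟨D, hD⟩ := exists_degree_bound_of_finite_genTypes M₀ (2 ^ ((Nat.log 2 M₀ + c) ^ c)) hfin
    have bound_mono_of_le : ∀ (m : ℕ) {a a' : ℕ}, a ≤ a' →
        (m : ℤ) * 2 ^ ((Nat.log 2 m + a) ^ a) ≤ (m : ℤ) * 2 ^ ((Nat.log 2 m + a') ^ a') := by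
      intro m a a' h
      have hmono : (Nat.log 2 m + a) ^ a ≤ (Nat.log 2 m + a') ^ a' := by
        rcases Nat.eq_zero_or_pos (Nat.log 2 m + a') with h0 | hpos
        · have ha' : a' = 0 := by omega
          have ha : a = 0 := by omega
          subst ha'; subst ha; simp
        · exact (Nat.pow_le_pow_left (by omega) a).trans (Nat.pow_le_pow_right hpos h)
      exact mul_le_mul_of_nonneg_left (pow_le_pow_right₀ (by norm_num) hmono) (by positivity)
    refine ⟨max c₀ (D + 1), fun m e hm he ι hι hup χ hγ => ?_⟩
    rcases Nat.lt_or_ge m M₀ with hlt | hge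
    · have h1 := hD m e hm hlt (e_le_of_window_of_lt hlt he) (Function.extend ι χ 0) hγ
      rw [Summit.ValiantsHypothesis.ValiantsHypothesis.Theorems.GenInheritance.size_extend hι.injective χ]
        at h1
      exact (h1.trans (le_bound_succ D m hm)).trans (bound_mono_of_le m (le_max_right _ _))
    · exact (hc₀ m e hge hm he ι hι hup χ hγ).trans (bound_mono_of_le m (le_max_left _ _))

/-- **`stub_wideGen` is asymptotic** (conditional reduction, same hypothesis): modulo finiteness of
the generator types of the cells `m < M₀`, the registered stub `stub_wideGen` (verbatim body on the
left) is equivalent to its restriction to the rows `m ≥ M₀`, for every `M₀`. [folklore] -/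
theorem stub_wideGen_iff_le_of_finite_genTypes (M₀ : ℕ)
    (hfin : ∀ m e : ℕ, 1 ≤ m → m < M₀ →
      Set.Finite {χ : Weight (MatIdx (m + e)) |
        Module.finrank ℂ (↥(highestWeightSpace (orbitCoordRep (powFormLex ℂ (m + e) m) m) χ) ⧸
          Submodule.comap (highestWeightSpace (orbitCoordRep (powFormLex ℂ (m + e) m) m) χ).subtype
            (⨆ p : Weight (MatIdx (m + e)) × Weight (MatIdx (m + e)),
              ⨆ (_ : p.1 + p.2 = χ ∧ p.1 ≠ 0 ∧ p.2 ≠ 0),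
                highestWeightSpace (orbitCoordRep (powFormLex ℂ (m + e) m) m) p.1 *
                  highestWeightSpace (orbitCoordRep (powFormLex ℂ (m + e) m) m) p.2)) ≠ 0}) :
    (∀ c : ℕ, ∃ c₀ : ℕ, ∀ m e : ℕ, 1 ≤ m → m + e ≤ 2 ^ ((Nat.log 2 m + c) ^ c) →
      ∀ ι : MatIdx m → MatIdx (m + e), StrictMono ι → IsUpperSet (Set.range ι) →
        ∀ χ : Weight (MatIdx (m + e)), (∃ x, x ∉ Set.range ι ∧ χ x ≠ 0) →
          Module.finrank ℂ (↥(highestWeightSpace (orbitCoordRep (powFormLex ℂ (m + e) m) m) (χ)) ⧸ Submodule.comap (highestWeightSpace (orbitCoordRep (powFormLex ℂ (m + e) m) m) (χ)).subtype (⨆ p : Weight (MatIdx (m + e)) × Weight (MatIdx (m + e)), ⨆ (_ : p.1 + p.2 = (χ) ∧ p.1 ≠ 0 ∧ p.2 ≠ 0), highestWeightSpace (orbitCoordRep (powFormLex ℂ (m + e) m) m) p.1 * highestWeightSpace (orbitCoordRep (powFormLex ℂ (m + e) m) m) p.2)) ≠ 0 →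
            -(Weight.size χ) ≤ (m : ℤ) * 2 ^ ((Nat.log 2 m + c₀) ^ c₀)) ↔
    (∀ c : ℕ, ∃ c₀ : ℕ, ∀ m e : ℕ, M₀ ≤ m → 1 ≤ m → m + e ≤ 2 ^ ((Nat.log 2 m + c) ^ c) →
      ∀ ι : MatIdx m → MatIdx (m + e), StrictMono ι → IsUpperSet (Set.range ι) →
        ∀ χ : Weight (MatIdx (m + e)), (∃ x, x ∉ Set.range ι ∧ χ x ≠ 0) →
          Module.finrank ℂ (↥(highestWeightSpace (orbitCoordRep (powFormLex ℂ (m + e) m) m) (χ)) ⧸ Submodule.comap (highestWeightSpace (orbitCoordRep (powFormLex ℂ (m + e) m) m) (χ)).subtype (⨆ p : Weight (MatIdx (m + e)) × Weight (MatIdx (m + e)), ⨆ (_ : p.1 + p.2 = (χ) ∧ p.1 ≠ 0 ∧ p.2 ≠ 0), highestWeightSpace (orbitCoordRep (powFormLex ℂ (m + e) m) m) p.1 * highestWeightSpace (orbitCoordRep (powFormLex ℂ (m + e) m) m) p.2)) ≠ 0 →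
            -(Weight.size χ) ≤ (m : ℤ) * 2 ^ ((Nat.log 2 m + c₀) ^ c₀)) := by
  constructor
  · intro h c
    obtain ⟨c₀, hc₀⟩ := h c
    exact ⟨c₀, fun m e _ hm he ι hι hup χ hw hγ => hc₀ m e hm he ι hι hup χ hw hγ⟩
  · intro h c
    obtain ⟨c₀, hc₀⟩ := h c
    obtain ⟨D, hD⟩ := exists_degree_bound_of_finite_genTypes M₀ (2 ^ ((Nat.log 2 M₀ + c) ^ c)) hfin
    have bound_mono_of_le : ∀ (m : ℕ) {a a' : ℕ}, a ≤ a' →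
        (m : ℤ) * 2 ^ ((Nat.log 2 m + a) ^ a) ≤ (m : ℤ) * 2 ^ ((Nat.log 2 m + a') ^ a') := by
      intro m a a' h
      have hmono : (Nat.log 2 m + a) ^ a ≤ (Nat.log 2 m + a') ^ a' := by
        rcases Nat.eq_zero_or_pos (Nat.log 2 m + a') with h0 | hpos
        · have ha' : a' = 0 := by omega
          have ha : a = 0 := by omega
          subst ha'; subst ha; simp
        · exact (Nat.pow_le_pow_left (by omega) a).trans (Nat.pow_le_pow_right hpos h)
      exact mul_le_mul_of_nonneg_left (pow_le_pow_right₀ (by norm_num) hmono) (by positivity)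
    refine ⟨max c₀ (D + 1), fun m e hm he ι hι hup χ hw hγ => ?_⟩
    rcases Nat.lt_or_ge m M₀ with hlt | hge
    · exact ((hD m e hm hlt (e_le_of_window_of_lt hlt he) χ hγ).trans (le_bound_succ D m hm)).trans
        (bound_mono_of_le m (le_max_right _ _))
    · exact (hc₀ m e hge hm he ι hι hup χ hw hγ).trans (bound_mono_of_le m (le_max_left _ _))

/-! ## The hypothesis from Hilbert's finiteness theorem for covariants of forms -/

/-- **Finiteness of generator types descends from the ambient covariant algebra**: if the algebra of
covariants `ℂ[Sym^m ℂ^{(m+e)²}]^U` of `m`-ary forms in `(m+e)²` variables has finitely many generator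
types (Hilbert's finiteness theorem for covariants, 1890 — the hypothesis, untyped), then so does the
covariant algebra of `Δ_m(tr X_{m+e}^m)`, by `γ_χ(Δ_m f) ≤ γ_χ(ℂ[Sym^m])`
(`…AmbientTransfer.gamma_orbitClosure_le_gamma_ambient`). [folklore] -/
theorem finite_genTypes_of_finite_ambient_genTypes (m e : ℕ) (hm : 1 ≤ m)
    (hamb : Set.Finite {χ : Weight (MatIdx (m + e)) |
      Module.finrank ℂ (↥(highestWeightSpace (coordRep (MatIdx (m + e)) ℂ m) χ) ⧸
        Submodule.comap (highestWeightSpace (coordRep (MatIdx (m + e)) ℂ m) χ).subtype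
          (⨆ p : Weight (MatIdx (m + e)) × Weight (MatIdx (m + e)),
            ⨆ (_ : p.1 + p.2 = χ ∧ p.1 ≠ 0 ∧ p.2 ≠ 0),
              highestWeightSpace (coordRep (MatIdx (m + e)) ℂ m) p.1 *
                highestWeightSpace (coordRep (MatIdx (m + e)) ℂ m) p.2)) ≠ 0}) :
    Set.Finite {χ : Weight (MatIdx (m + e)) |
      Module.finrank ℂ (↥(highestWeightSpace (orbitCoordRep (powFormLex ℂ (m + e) m) m) χ) ⧸
        Submodule.comap (highestWeightSpace (orbitCoordRep (powFormLex ℂ (m + e) m) m) χ).subtype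
          (⨆ p : Weight (MatIdx (m + e)) × Weight (MatIdx (m + e)),
            ⨆ (_ : p.1 + p.2 = χ ∧ p.1 ≠ 0 ∧ p.2 ≠ 0),
              highestWeightSpace (orbitCoordRep (powFormLex ℂ (m + e) m) m) p.1 *
                highestWeightSpace (orbitCoordRep (powFormLex ℂ (m + e) m) m) p.2)) ≠ 0} := by
  refine hamb.subset fun χ hχ => ?_
  simp only [Set.mem_setOf_eq] at hχ ⊢
  intro h0
  have h := Summit.ValiantsHypothesis.ValiantsHypothesis.Theorems.GeneratorObstructions.PerGenDegreeSuperQP.gamma_orbitClosure_le_gamma_ambient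
    (powFormLex ℂ (m + e) m) (show m ≠ 0 by omega) χ
  rw [h0] at h
  exact hχ (Nat.le_zero.mp h)

/-- **K2 is asymptotic, conditional only on Hilbert's finiteness theorem for covariants**: if for the
finitely many shapes `(m, (m+e)²)`, `m < M₀`, the classical algebra of covariants of `m`-ary forms in
`(m+e)²` variables has finitely many generator types, then the route decl `PowGenDegreeQP` (verbatim)
is equivalent to its restriction to the rows `m ≥ M₀`. [folklore] -/
theorem powGenDegreeQP_iff_le_of_finite_ambient_genTypes (M₀ : ℕ)
    (hamb : ∀ m e : ℕ, 1 ≤ m → m < M₀ →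
      Set.Finite {χ : Weight (MatIdx (m + e)) |
        Module.finrank ℂ (↥(highestWeightSpace (coordRep (MatIdx (m + e)) ℂ m) χ) ⧸
          Submodule.comap (highestWeightSpace (coordRep (MatIdx (m + e)) ℂ m) χ).subtype
            (⨆ p : Weight (MatIdx (m + e)) × Weight (MatIdx (m + e)),
              ⨆ (_ : p.1 + p.2 = χ ∧ p.1 ≠ 0 ∧ p.2 ≠ 0),
                highestWeightSpace (coordRep (MatIdx (m + e)) ℂ m) p.1 *
                  highestWeightSpace (coordRep (MatIdx (m + e)) ℂ m) p.2)) ≠ 0}) :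
    PowGenDegreeQP ↔
      ∀ c : ℕ, ∃ c₀ : ℕ, ∀ m e : ℕ, M₀ ≤ m → 1 ≤ m → m + e ≤ 2 ^ ((Nat.log 2 m + c) ^ c) →
        ∀ χ : Weight (MatIdx (m + e)),
          Module.finrank ℂ (↥(highestWeightSpace (orbitCoordRep (powFormLex ℂ (m + e) m) m) χ) ⧸
            Submodule.comap (highestWeightSpace (orbitCoordRep (powFormLex ℂ (m + e) m) m) χ).subtype
              (⨆ p : Weight (MatIdx (m + e)) × Weight (MatIdx (m + e)),
                ⨆ (_ : p.1 + p.2 = χ ∧ p.1 ≠ 0 ∧ p.2 ≠ 0),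
                  highestWeightSpace (orbitCoordRep (powFormLex ℂ (m + e) m) m) p.1 *
                    highestWeightSpace (orbitCoordRep (powFormLex ℂ (m + e) m) m) p.2)) ≠ 0 →
          -(Weight.size χ) ≤ (m : ℤ) * 2 ^ ((Nat.log 2 m + c₀) ^ c₀) :=
  powGenDegreeQP_iff_le_of_finite_genTypes M₀ fun m e hm hM =>
    finite_genTypes_of_finite_ambient_genTypes m e hm (hamb m e hm hM)

end

end Summit.ValiantsHypothesis.ValiantsHypothesis.Theorems.GeneratorObstructions.PowGenDegreeQP
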